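import Literature.AlgebraicGeometry.HodgeTheory.JacobianRingPrimitiveMiddleBettiNumber
import Literature.AlgebraicGeometry.HodgeTheory.BettiHypersurfaceThreefoldHodgeNumbersIntermediateJacobian
import Literature.RingTheory.HilbertSamuel.PolynomialRing
import HarnessLib

/-!
# The degree-`d` piece of the Jacobian ring counts the moduli: `dim_K R_F^d = C(n+d+1, d) − (n+2)²` and `dim_K J_F^d = (n+2)²` for every form `F` of degree `d ≥ 3` in `n + 2` variables with
# finite-dimensional Jacobian ring (Movasati 2016 Def. 1; Huybrechts 2023 Ch. 1 §2.1, (2.2): cubics `C(n+2, 3)`; Voisin II §6.2.1); the quintic threefold: `dim R_F^5 = 101 = h^{2,1}`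

Family `hodge`, lane `lit-hodgefound` (Track 2 foundations library; Layers A1/A4), layer `Literature/AlgebraicGeometry/HodgeTheory`.  THEOREMS ONLY (no definition, no named fact, no instance,
no notation; D-0026 net debt `0`).  Prover seat `lit-hodgefound-p21` (generation 42, row g42-#6), sequel of g42-#4 (`JacobianRingPrimitiveMiddleBettiNumber`: Macaulay's box count `dim_K R_F^a = #I_a`,
`I_a = {β ∈ [0, d−2]^{n+2} : |β| = a}`, for every form with finite Jacobian ring; nonsingular forms qualify).

THE MATHEMATICS.  H. Movasati, *Why should one compute periods of algebraic cycles?*, Definition 1: «the numbers `#I_d, #I_{(n/2)d−n−2}, #I_{(n/2+1)d−n−2}` are respectively the dimension of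
the moduli space, …, of smooth hypersurfaces of dimension `n` and degree `d`».  D. Huybrechts, *The Geometry of Cubic Hypersurfaces*, Ch. 1 §2.1: hypersurfaces of degree `d` in
`ℙ = ℙ^{n+1}` form `|𝒪_ℙ(d)| ≅ ℙ^{N(d,n)}`, «`N(d,n) = C(n+1+d, d) − 1`», with the action of `PGL(n+2)` (of dimension `(n+2)² − 1`); for cubics «the closed formula for the dimension of the moduli space
is (2.2) `dim(M_n) = C(n+2, 3)`» (`0, 1, 4, 10, 20, 35` for `n = 0, …, 5`).  C. Voisin, *Hodge Theory II*, §6.2.1 (Lemma 6.15): the tangent space to the orbit of `f` under `GL(n+2)` in `S^d` is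
`J_f^d`, spanned by the `xᵢ ∂ⱼf`, so that `R_f^d = S^d/J_f^d` is the space of first-order deformations of the hypersurface modulo projective transformations.  THE COUNT (§1): for `d ≥ 3` an
exponent vector `β` of degree `d` in `n + 2` variables lies OUTSIDE the box `[0, d−2]^{n+2}` iff some `βᵢ ≥ d − 1`, and then `β = (d−1)εᵢ + εⱼ` for a unique pair `(i, j)` (`j = i` when `βᵢ = d`):
the complement of `I_d` in the `C(n+d+1, d)` monomials of degree `d` has exactly `(n+2)²` elements — the monomials `xᵢ^{d−1}xⱼ`, one for each product `xⱼ ∂ᵢ(Σ x_k^d)/d`.  Hence (§2)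
**`dim_K R_F^d = #I_d = C(n+d+1, d) − (n+2)²`** and **`dim_K J_F^d = (n+2)²`** (the `(n+2)²` forms `xᵢ ∂ⱼF` are linearly independent) for every `F` of degree `d ≥ 3` with finite Jacobian ring:
cubic curve∕surface∕threefold∕fourfold∕fivefold `1, 4, 10, 20, 35` (`= C(n+2, 3)`, (2.2)), quartic surface `19`, quintic threefold `101`, sextic fourfold `426`; and (§3) for the quintic threefold
`dim R_F^5 = 101 = h^{2,1}(T)` (g42-#2's `hodgeNumber_two_one_quinticThreefold`) — the number of complex moduli of the Calabi–Yau threefold equals `h^{2,1}` (numerically; `R_f^d ≅ H^{n−1,1}(Y)_prim` for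
`d = n + 2` is Griffiths' theorem, not used).

THE OBJECTS (all the tree's or Mathlib's).  `MvPolynomial (Fin (n+2)) K`, `homogeneousSubmodule`, `UniversalHypersurface.jacobianIdeal F`, `idealDegree`, `Finset.finsuppAntidiag`, `Finsupp.single`;
`hilbert_jacobianIdeal_eq_card_of_finite` (`CompleteIntersectionHilbertFunction`), `HilbertSamuel.finrank_homogeneousSubmodule_eq_card`, `HilbertSamuel.finrank_homogeneousSubmodule_fin` (stars and bars),
`SmoothHypersurface.IsNonsingularForm.moduleFinite_quotient_jacobianIdeal` (g42-#4), `IsSmoothHypersurface.hodgeNumber_two_one_quinticThreefold` (g42-#2).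

WHAT IS PROVED.
* §1 `card_finsuppAntidiag_univ_fin` (`#{β : |β| = a} = C(a+n+1, a)` on `n + 2` variables), (private) `single_add_single_injective` (`(i,j) ↦ (d−1)εᵢ + εⱼ` injective, `d ≥ 3`),
  `filter_finsuppAntidiag_exists_le_eq_image` (the complement of the box is its image), **`card_filter_finsuppAntidiag_exists_le`** (`= (n+2)²`), **`card_box_degree_add_sq`** (`#I_d + (n+2)² = C(n+d+1, d)`).
* §2 **`hilbert_jacobianIdeal_degree_add_sq`** (`dim R_F^d + (n+2)² = C(n+d+1, d)`), **`hilbert_jacobianIdeal_degree_eq`** (`dim R_F^d = C(n+d+1,d) − (n+2)²`), **`finrank_idealDegree_jacobianIdeal_degree`**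
  (`dim J_F^d = (n+2)²`), `hilbert_jacobianIdeal_degree_cubic` (`= C(n+2, 3)`), instances `…cubicThreefold` (`10`), `…cubicFourfold` (`20`), `…quarticSurface` (`19`), `…quinticThreefold` (`101`), `…sexticFourfold` (`426`).
* §3 `hilbert_jacobianIdeal_quintic_eq_hodgeNumber_two_one` (`dim R_F^5 = h^{2,1}(T) = 101` for a nonsingular quintic `F` in five variables and any smooth quintic threefold `T`).

DEVIATIONS / SCOPE.  The identification of `R_F^d` with `H¹(X, T_X)` ∕ the tangent space of the moduli space (Kodaira–Spencer; Huybrechts §3.3, Voisin II Lemma 6.15) is NOT formalised — only the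
number; `d = 2` (quadrics: `J_F^2 = S^2`, `R^2 = 0`) is excluded from §1's count (there `dεᵢ` and `(d−1)εᵢ + εⱼ` patterns overlap differently) but covered trivially by `hilbert_span_X_pow_pos_iff`.

## References
* [Movasati2016Periods] H. Movasati, *Why should one compute periods of algebraic cycles?*, arXiv:1602.06607 — Definition 1.
* [Huybrechts2023Cubic] D. Huybrechts, *The Geometry of Cubic Hypersurfaces*, CUP (2023) — Ch. 1 §2.1 (`N(d,n)`, table, (2.2)) (held text pp. 33–34); §3.3 (p. 56); Ch. 5 §0.1 (p. 227: «moduli space of smooth cubic threefolds is of dimension 10»).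
* [VoisinHodgeII2003] C. Voisin, *Hodge Theory and Complex Algebraic Geometry II* (2003) — §6.2.1 Lemma 6.15; §6.1.3 Cor. 6.12.
* [CarlsonMullerStachPeters2017] J. Carlson, S. Müller-Stach, C. Peters, *Period Mappings and Period Domains*, 2nd ed. (2017) — §7.4.

## Provenance
Lane `lit-hodgefound` (Hodge path, Track 2), prover seat `lit-hodgefound-p21` (generation 42), self-proposed row g42-#6.
-/

noncomputable section

open MvPolynomial Module Finset
open Literature.RingTheory.MvPolynomial
open Literature.AlgebraicGeometry.Motives.UniversalHypersurface
open Literature.AlgebraicTopology.SingularHomology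

namespace Literature.AlgebraicGeometry.HodgeTheory

open Literature.AlgebraicGeometry.Motives

/-! ### §1 The exponents of degree `d` outside the box `[0, d−2]^{n+2}` -/

section Count

variable (n d : ℕ)

/-- Membership in `univ.finsuppAntidiag a`: `|β| = a` (plumbing). [folklore] -/
private theorem mem_antidiag_iff {a : ℕ} {β : Fin (n + 2) →₀ ℕ} : β ∈ (univ : Finset (Fin (n + 2))).finsuppAntidiag a ↔ ∑ i, β i = a := by
  rw [Finset.mem_finsuppAntidiag]
  simp

/-- **Stars and bars: `#{β : Fin (n+2) →₀ ℕ : |β| = a} = C(a + n + 1, a)`** (the monomials of degree `a` in `n + 2` variables; Huybrechts' `N(d,n) + 1 = C(n+1+d, d)`).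
[cite: Huybrechts2023Cubic, Ch. 1 §2.1 (held text p. 33)] -/
theorem card_finsuppAntidiag_univ_fin (a : ℕ) : ((univ : Finset (Fin (n + 2))).finsuppAntidiag a).card = (a + n + 1).choose a := by
  classical
  rw [← Literature.RingTheory.HilbertSamuel.finrank_homogeneousSubmodule_eq_card ℚ (Fin (n + 2)) a, Literature.RingTheory.HilbertSamuel.finrank_homogeneousSubmodule_fin ℚ (n + 2) a,
    show a + (n + 2) - 1 = a + n + 1 by omega]

/-- **`(i, j) ↦ (d−1)εᵢ + εⱼ` is injective for `d ≥ 3`** (the index `i` is recovered as the coordinate `≥ 2`, then `εⱼ` by cancellation). [folklore] -/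
private theorem single_add_single_injective (hd : 3 ≤ d) :
    Function.Injective fun ij : Fin (n + 2) × Fin (n + 2) => Finsupp.single ij.1 (d - 1) + Finsupp.single ij.2 1 := by
  rintro ⟨i, j⟩ ⟨i', j'⟩ h
  dsimp only at h
  have hi : i = i' := by
    by_contra hne
    have h1 : (Finsupp.single i (d - 1) + Finsupp.single j 1 : Fin (n + 2) →₀ ℕ) i = (Finsupp.single i' (d - 1) + Finsupp.single j' 1 : Fin (n + 2) →₀ ℕ) i := by
      rw [h]
    rw [Finsupp.add_apply, Finsupp.add_apply, Finsupp.single_eq_same, Finsupp.single_apply, Finsupp.single_apply, Finsupp.single_apply,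
      if_neg (Ne.symm hne)] at h1
    split_ifs at h1 <;> omega
  subst hi
  have hj : Finsupp.single j 1 = Finsupp.single j' (1 : ℕ) := add_left_cancel h
  rw [Prod.mk.injEq]
  exact ⟨rfl, Finsupp.single_left_injective one_ne_zero hj⟩

/-- **The exponents of degree `d` outside the box are the `(d−1)εᵢ + εⱼ`**: for `d ≥ 3`, `{β : |β| = d, ∃ i, βᵢ ≥ d − 1} = {(d−1)εᵢ + εⱼ : i, j}` (`βᵢ ∈ {d−1, d}`; the remaining mass `≤ 1` sits at one
index `j`). [cite: Movasati2016Periods, Definition 1] [cite: VoisinHodgeII2003, §6.2.1 Lemma 6.15] -/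
theorem filter_finsuppAntidiag_exists_le_eq_image (hd : 3 ≤ d) :
    ((univ : Finset (Fin (n + 2))).finsuppAntidiag d).filter (fun β : Fin (n + 2) →₀ ℕ => ∃ i, d - 1 ≤ β i) =
      (univ : Finset (Fin (n + 2) × Fin (n + 2))).image fun ij => Finsupp.single ij.1 (d - 1) + Finsupp.single ij.2 1 := by
  classical
  ext β
  rw [mem_filter, mem_antidiag_iff, mem_image]
  constructor
  · rintro ⟨hsum, i, hi⟩
    have hrest : β i + ∑ x ∈ univ.erase i, β x = ∑ x, β x := Finset.add_sum_erase _ _ (mem_univ i)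
    by_cases hid : β i = d
    · -- `β = d εᵢ = (d−1)εᵢ + εᵢ`: every other coordinate vanishes
      refine ⟨(i, i), mem_univ _, ?_⟩
      ext k
      by_cases hk : i = k
      · subst hk
        rw [Finsupp.add_apply, Finsupp.single_eq_same, Finsupp.single_eq_same]
        omega
      · rw [Finsupp.add_apply, Finsupp.single_apply, Finsupp.single_apply, if_neg hk, if_neg hk]
        have hmem : k ∈ univ.erase i := Finset.mem_erase.2 ⟨Ne.symm hk, mem_univ k⟩
        have hkle : β k ≤ ∑ x ∈ univ.erase i, β x := Finset.single_le_sum (fun x _ => Nat.zero_le (β x)) hmem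
        omega
    · -- `βᵢ = d − 1`: the remaining mass `1` sits at one index `j ≠ i`
      have hone : ∑ x ∈ univ.erase i, β x = 1 := by omega
      obtain ⟨j, hj, hj0⟩ := Finset.exists_ne_zero_of_sum_ne_zero (show ∑ x ∈ univ.erase i, β x ≠ 0 by omega)
      have hjle : β j ≤ ∑ x ∈ univ.erase i, β x := Finset.single_le_sum (fun x _ => Nat.zero_le (β x)) hj
      have hji : j ≠ i := (Finset.mem_erase.1 hj).1
      have hrest' : β j + ∑ x ∈ (univ.erase i).erase j, β x = ∑ x ∈ univ.erase i, β x := Finset.add_sum_erase _ _ hj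
      refine ⟨(i, j), mem_univ _, ?_⟩
      ext k
      by_cases hki : i = k
      · subst hki
        rw [Finsupp.add_apply, Finsupp.single_eq_same, Finsupp.single_apply, if_neg hji]
        omega
      · by_cases hkj : j = k
        · subst hkj
          rw [Finsupp.add_apply, Finsupp.single_apply, if_neg hki, Finsupp.single_eq_same]
          omega
        · rw [Finsupp.add_apply, Finsupp.single_apply, Finsupp.single_apply, if_neg hki, if_neg hkj]
          have hmem : k ∈ (univ.erase i).erase j := Finset.mem_erase.2 ⟨Ne.symm hkj, Finset.mem_erase.2 ⟨Ne.symm hki, mem_univ k⟩⟩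
          have hkle : β k ≤ ∑ x ∈ (univ.erase i).erase j, β x := Finset.single_le_sum (fun x _ => Nat.zero_le (β x)) hmem
          omega
  · rintro ⟨⟨i, j⟩, -, rfl⟩
    refine ⟨?_, i, ?_⟩
    · simp only [Finsupp.coe_add, Pi.add_apply, Finset.sum_add_distrib, Finsupp.single_apply, Finset.sum_ite_eq, mem_univ, if_true]
      omega
    · rw [Finsupp.add_apply, Finsupp.single_eq_same]
      omega

/-- **Exactly `(n+2)²` exponents of degree `d ≥ 3` lie outside Movasati's box** (one for each `xᵢ^{d−1} xⱼ`, i.e. for each `xⱼ ∂ᵢ`). [cite: Movasati2016Periods, Definition 1]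
[cite: Huybrechts2023Cubic, Ch. 1 §2.1 (`dim PGL(n+2) = (n+2)² − 1`)] -/
theorem card_filter_finsuppAntidiag_exists_le (hd : 3 ≤ d) :
    (((univ : Finset (Fin (n + 2))).finsuppAntidiag d).filter fun β : Fin (n + 2) →₀ ℕ => ∃ i, d - 1 ≤ β i).card = (n + 2) ^ 2 := by
  classical
  rw [filter_finsuppAntidiag_exists_le_eq_image n d hd, Finset.card_image_of_injective _ (single_add_single_injective n d hd), card_univ, Fintype.card_prod,
    Fintype.card_fin, sq]

/-- **`#I_d + (n+2)² = C(n+d+1, d)`** for `d ≥ 3`: Movasati's `#I_d = #{β ∈ [0, d−2]^{n+2} : |β| = d}` is the number of degree-`d` monomials minus `(n+2)²`. [cite: Movasati2016Periods, Definition 1]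
[cite: Huybrechts2023Cubic, Ch. 1 §2.1 and (2.2)] -/
theorem card_box_degree_add_sq (hd : 3 ≤ d) :
    (((univ : Finset (Fin (n + 2))).finsuppAntidiag d).filter fun β : Fin (n + 2) →₀ ℕ => ∀ i, β i ≤ d - 2).card + (n + 2) ^ 2 = (n + d + 1).choose d := by
  classical
  rw [← card_filter_finsuppAntidiag_exists_le n d hd]
  have h := Finset.card_filter_add_card_filter_not (s := (univ : Finset (Fin (n + 2))).finsuppAntidiag d) (fun β : Fin (n + 2) →₀ ℕ => ∀ i, β i ≤ d - 2)
  have hneg : ((univ : Finset (Fin (n + 2))).finsuppAntidiag d).filter (fun β : Fin (n + 2) →₀ ℕ => ¬ ∀ i, β i ≤ d - 2) =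
      ((univ : Finset (Fin (n + 2))).finsuppAntidiag d).filter fun β : Fin (n + 2) →₀ ℕ => ∃ i, d - 1 ≤ β i := by
    refine Finset.filter_congr fun β _ => ?_
    simp only [not_forall, not_le]
    exact exists_congr fun i => by omega
  rw [hneg, card_finsuppAntidiag_univ_fin n d, show d + n + 1 = n + d + 1 by omega] at h
  exact h

end Count

/-! ### §2 `dim_K R_F^d = C(n+d+1, d) − (n+2)²`, `dim_K J_F^d = (n+2)²` -/

section JacobianRing

variable {K : Type*} [Field K] {n d : ℕ}

/-- **`dim_K R_F^d + (n+2)² = C(n+d+1, d)`** for every form `F` of degree `d ≥ 3` in `n + 2` variables with finite-dimensional Jacobian ring (`dim R_F^d = #I_d`, Macaulay ∕ Movasati).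
[cite: Movasati2016Periods, Definition 1] [cite: Huybrechts2023Cubic, Ch. 1 §2.1 and (2.2)] [cite: VoisinHodgeII2003, §6.2.1 Lemma 6.15] -/
theorem hilbert_jacobianIdeal_degree_add_sq {F : MvPolynomial (Fin (n + 2)) K} (hF : F.IsHomogeneous d) (hd : 3 ≤ d) [Module.Finite K (MvPolynomial (Fin (n + 2)) K ⧸ jacobianIdeal F)] :
    finrank K (homogeneousSubmodule (Fin (n + 2)) K d) - finrank K (idealDegree (jacobianIdeal F) d) + (n + 2) ^ 2 = (n + d + 1).choose d := by
  rw [hilbert_jacobianIdeal_eq_card_of_finite hF (by omega) d]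
  exact card_box_degree_add_sq n d hd

/-- **The number of moduli: `dim_K R_F^d = C(n+d+1, d) − (n+2)²`** for every form `F` of degree `d ≥ 3` in `n + 2` variables with finite Jacobian ring («`#I_d` … the dimension of the moduli
space»; `N(d,n) − dim PGL(n+2) = C(n+1+d, d) − 1 − ((n+2)² − 1)`). [cite: Movasati2016Periods, Definition 1] [cite: Huybrechts2023Cubic, Ch. 1 §2.1 and (2.2)] [cite: VoisinHodgeII2003, §6.2.1 Lemma 6.15] -/
theorem hilbert_jacobianIdeal_degree_eq {F : MvPolynomial (Fin (n + 2)) K} (hF : F.IsHomogeneous d) (hd : 3 ≤ d) [Module.Finite K (MvPolynomial (Fin (n + 2)) K ⧸ jacobianIdeal F)] :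
    finrank K (homogeneousSubmodule (Fin (n + 2)) K d) - finrank K (idealDegree (jacobianIdeal F) d) = (n + d + 1).choose d - (n + 2) ^ 2 := by
  have h := hilbert_jacobianIdeal_degree_add_sq hF hd
  omega

/-- **`dim_K J_F^d = (n+2)²`**: the `(n+2)²` degree-`d` forms `xᵢ ∂ⱼF` spanning `J_F^d` are linearly independent, for every form `F` of degree `d ≥ 3` in `n + 2` variables with finite Jacobian ring
(`dim S^d = C(n+d+1, d)`). [cite: VoisinHodgeII2003, §6.2.1 Lemma 6.15] [cite: Huybrechts2023Cubic, Ch. 1 §2.1] -/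
theorem finrank_idealDegree_jacobianIdeal_degree {F : MvPolynomial (Fin (n + 2)) K} (hF : F.IsHomogeneous d) (hd : 3 ≤ d) [Module.Finite K (MvPolynomial (Fin (n + 2)) K ⧸ jacobianIdeal F)] :
    finrank K (idealDegree (jacobianIdeal F) d) = (n + 2) ^ 2 := by
  have h := hilbert_jacobianIdeal_degree_add_sq hF hd
  have hS : finrank K (homogeneousSubmodule (Fin (n + 2)) K d) = (n + d + 1).choose d := by
    rw [Literature.RingTheory.HilbertSamuel.finrank_homogeneousSubmodule_fin K (n + 2) d, show d + (n + 2) - 1 = n + d + 1 by omega]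
  haveI : Module.Finite K (homogeneousSubmodule (Fin (n + 2)) K d) :=
    Module.finite_of_finrank_pos (by rw [hS]; exact Nat.choose_pos (by omega))
  have hle : finrank K (idealDegree (jacobianIdeal F) d) ≤ finrank K (homogeneousSubmodule (Fin (n + 2)) K d) :=
    Submodule.finrank_mono inf_le_right
  omega

/-- `C(n+4, 3) = C(n+2, 3) + (n+2)²` (Pascal twice; plumbing for (2.2)). [cite: Huybrechts2023Cubic, Ch. 1 §2.1 (2.2)] -/
private theorem choose_add_four_three (n : ℕ) : (n + 4).choose 3 = (n + 2).choose 3 + (n + 2) ^ 2 := by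
  have h1 : (n + 4).choose 3 = (n + 3).choose 2 + (n + 3).choose 3 := Nat.choose_succ_succ (n + 3) 2
  have h2 : (n + 3).choose 3 = (n + 2).choose 2 + (n + 2).choose 3 := Nat.choose_succ_succ (n + 2) 2
  have h3 : (n + 3).choose 2 = (n + 2).choose 1 + (n + 2).choose 2 := Nat.choose_succ_succ (n + 2) 1
  have h4 : (n + 2) + 2 * (n + 2).choose 2 = (n + 2) ^ 2 := by
    have := Nat.choose_two_right (n + 2)
    have heven : 2 ∣ (n + 2) * (n + 1) := (Nat.even_mul_succ_self (n + 1)).two_dvd |>.elim (fun c hc => ⟨c, by nlinarith [hc]⟩)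
    rw [this, show n + 2 - 1 = n + 1 by omega, Nat.mul_div_cancel' heven]
    ring
  rw [Nat.choose_one_right] at h3
  omega

/-- **Cubics: `dim_K R_F^3 = C(n+2, 3)`** for every cubic form in `n + 2` variables with finite Jacobian ring — Huybrechts' (2.2) «`dim(M_n) = C(n+2, 3) = (n³ + 3n² + 2n)/6`» (`0, 1, 4, 10, 20, 35`).
[cite: Huybrechts2023Cubic, Ch. 1 §2.1 (2.2) and the table (held text p. 34)] [cite: Movasati2016Periods, Definition 1] -/
theorem hilbert_jacobianIdeal_degree_cubic {F : MvPolynomial (Fin (n + 2)) K} (hF : F.IsHomogeneous 3) [Module.Finite K (MvPolynomial (Fin (n + 2)) K ⧸ jacobianIdeal F)] :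
    finrank K (homogeneousSubmodule (Fin (n + 2)) K 3) - finrank K (idealDegree (jacobianIdeal F) 3) = (n + 2).choose 3 := by
  rw [hilbert_jacobianIdeal_degree_eq hF le_rfl, show n + 3 + 1 = n + 4 by omega, choose_add_four_three, Nat.add_sub_cancel]

/-- **`dim R_F^3 = 10` for a cubic threefold** («the moduli space of smooth cubic threefolds is of dimension `10` … `dim H¹(Y, T_Y) = 10`»). [cite: Huybrechts2023Cubic, Ch. 5 §0.1 (p. 227) and Ch. 1 (2.2)] -/
theorem hilbert_jacobianIdeal_degree_cubicThreefold {F : MvPolynomial (Fin (3 + 2)) K} (hF : F.IsHomogeneous 3) [Module.Finite K (MvPolynomial (Fin (3 + 2)) K ⧸ jacobianIdeal F)] :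
    finrank K (homogeneousSubmodule (Fin (3 + 2)) K 3) - finrank K (idealDegree (jacobianIdeal F) 3) = 10 := by
  rw [hilbert_jacobianIdeal_degree_cubic hF]
  rfl

/-- `dim R_F^3 = 20` for a cubic fourfold. [cite: Huybrechts2023Cubic, Ch. 1 §2.1 (2.2) and the table (p. 34)] -/
theorem hilbert_jacobianIdeal_degree_cubicFourfold {F : MvPolynomial (Fin (4 + 2)) K} (hF : F.IsHomogeneous 3) [Module.Finite K (MvPolynomial (Fin (4 + 2)) K ⧸ jacobianIdeal F)] :
    finrank K (homogeneousSubmodule (Fin (4 + 2)) K 3) - finrank K (idealDegree (jacobianIdeal F) 3) = 20 := by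
  rw [hilbert_jacobianIdeal_degree_cubic hF]
  rfl

/-- **`dim R_F^4 = 19` for a quartic surface** (`C(7,4) − 16`; the `19` moduli of quartic K3 surfaces). [cite: Movasati2016Periods, Definition 1] [cite: VoisinHodgeII2003, §6.2.1 Lemma 6.15] -/
theorem hilbert_jacobianIdeal_degree_quarticSurface {F : MvPolynomial (Fin (2 + 2)) K} (hF : F.IsHomogeneous 4) [Module.Finite K (MvPolynomial (Fin (2 + 2)) K ⧸ jacobianIdeal F)] :
    finrank K (homogeneousSubmodule (Fin (2 + 2)) K 4) - finrank K (idealDegree (jacobianIdeal F) 4) = 19 := by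
  rw [hilbert_jacobianIdeal_degree_eq hF (by norm_num)]
  rfl

/-- **`dim R_F^5 = 101` for a quintic threefold** (`C(9,5) − 25`). [cite: Movasati2016Periods, Definition 1] [cite: VoisinHodgeII2003, §6.2.1 Lemma 6.15] -/
theorem hilbert_jacobianIdeal_degree_quinticThreefold {F : MvPolynomial (Fin (3 + 2)) K} (hF : F.IsHomogeneous 5) [Module.Finite K (MvPolynomial (Fin (3 + 2)) K ⧸ jacobianIdeal F)] :
    finrank K (homogeneousSubmodule (Fin (3 + 2)) K 5) - finrank K (idealDegree (jacobianIdeal F) 5) = 101 := by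
  rw [hilbert_jacobianIdeal_degree_eq hF (by norm_num)]
  rfl

/-- `dim R_F^6 = 426` for a sextic fourfold (`C(11,6) − 36`). [cite: Movasati2016Periods, Definition 1] -/
theorem hilbert_jacobianIdeal_degree_sexticFourfold {F : MvPolynomial (Fin (4 + 2)) K} (hF : F.IsHomogeneous 6) [Module.Finite K (MvPolynomial (Fin (4 + 2)) K ⧸ jacobianIdeal F)] :
    finrank K (homogeneousSubmodule (Fin (4 + 2)) K 6) - finrank K (idealDegree (jacobianIdeal F) 6) = 426 := by
  rw [hilbert_jacobianIdeal_degree_eq hF (by norm_num)]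
  rfl

end JacobianRing

/-! ### §3 The quintic threefold: `dim R_F^5 = 101 = h^{2,1}` -/

section Quintic

variable {T : SchemeOver ℂ}

/-- **«The number of complex moduli equals `h^{2,1}`» for the quintic threefold, numerically: `dim_ℂ R_F^5 = h^{2,1}(T) (= 101)`** for a NONSINGULAR quintic form `F` in five variables and any smooth
quintic threefold `T ⊂ ℙ⁴_ℂ` (`R_F^5 ≅ H^{2,1}(X_F)` is Griffiths' isomorphism for the Calabi–Yau case `d = n + 2`, not used). [cite: VoisinHodgeII2003, §6.1.3 Cor. 6.12 and §6.2.1 Lemma 6.15]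
[cite: Movasati2016Periods, Definition 1] [cite: Huybrechts2023Cubic, Ch. 1 §1.3 Cor. 1.12] -/
theorem hilbert_jacobianIdeal_quintic_eq_hodgeNumber_two_one {F : MvPolynomial (Fin (3 + 2)) ℂ} (hF : F.IsHomogeneous 5) (hFns : SmoothHypersurface.IsNonsingularForm ℂ F)
    (hT : IsSmoothHypersurface 3 5 T) (hHD : exists_isReal_hodgeModel) :
    finrank ℂ (homogeneousSubmodule (Fin (3 + 2)) ℂ 5) - finrank ℂ (idealDegree (jacobianIdeal F) 5) = (BettiUniverse.hodge hHD hT.1 3).hodgeNumber 2 1 := by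
  haveI := hFns.moduleFinite_quotient_jacobianIdeal hF (by norm_num)
  rw [hilbert_jacobianIdeal_degree_quinticThreefold hF, hT.hodgeNumber_two_one_quinticThreefold hHD]

end Quintic

end Literature.AlgebraicGeometry.HodgeTheory

end
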